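import Mathlib
import Literature.Computability.Complexity.RangeAvoidance
import Summits.PneNP.PneNP.Theorems.QuotientSABlocks
import Summits.PneNP.PneNP.Theorems.AffineAndLaws

/-!
# Cosets of the cut space of `K_{s+1}` are non-empty and 2-wise uniform (cell `pnp-ideate`, ROUND-22, B1 `cutCoset2Uniform`)

FRONTIER range-avoidance ladder, rung F-N3 context (restricted-model lower bounds; nothing here bears on `P` vs `NP`).
For the block construction of `QuotientSABlocks` (blocks `K_{s+1}` with apex `0`): an edge labelling
`z : Fin #E → Bool` (edges enumerated by `QuotientSABlocks.eEdge`) has APEX-TRIANGLE PARITIES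
`triXor z τ = z_{0v⁺} ⊕ z_{0w⁺} ⊕ z_{v⁺w⁺}`; the PATTERN SET `patSet c = {z | ∀ τ, triXor z τ = c τ}` of prescribed parities
`c` is a coset of the cut space `Cut(K_{s+1})` (the apex triangles are a basis of the cycle space).  Proved:
* `patSet_nonempty` — the section `zSec` (zero on apex edges, `c` on the others);
* `unif1_patSet`, `unif2_patSet` — `patSet c` is 1- and 2-WISE UNIFORM (`AffineAndLaws.Unif1/Unif2`): flipping `z` along the
  cut of a single vertex `x` (`cutFlip x`) preserves every apex parity (a triangle has `0` or `2` edges at `x`), flips the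
  bit of every edge at `x` and fixes the others; for two distinct edges some vertex lies on the first and off the second
  (`exists_inc_ne`) — i.e. `Cycle(K_t) = Cut(K_t)^⊥` has minimum weight `3`;
* the two abstract counting lemmas behind it (`two_mul_card_filter`, `four_mul_card_filter`: an `A`-preserving involution
  negating a predicate halves, two such quarter).
Consumed by `QuotientSABlockLaws` (T22.1a(ii) `BlockLaws`).
-/

set_option linter.dupNamespace false

open Finset
open Summit.PneNP.PneNP.Theorems.QuotientSABlocks
open Summit.PneNP.PneNP.Theorems.AffineAndLaws (Unif1 Unif2)

namespace Summit.PneNP.PneNP.Theorems.QuotientSACutCoset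

/-! ## Two counting lemmas -/

/-- An `A`-preserving involution that negates `P` splits `A` into two halves. -/
theorem two_mul_card_filter {X : Type*} (A : Finset X) (f : X → X) (P : X → Prop) [DecidablePred P]
    (hA : ∀ x ∈ A, f x ∈ A) (hf : ∀ x, f (f x) = x) (hP : ∀ x, P (f x) ↔ ¬ P x) :
    2 * (A.filter P).card = A.card := by
  have h := Finset.card_filter_add_card_filter_not (s := A) P
  have hc : (A.filter fun x => ¬ P x).card = (A.filter P).card := by
    refine Finset.card_bij' (fun x _ => f x) (fun x _ => f x) ?_ ?_ (fun x _ => hf x) (fun x _ => hf x)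
    · intro x hx
      rw [Finset.mem_filter] at hx ⊢
      exact ⟨hA x hx.1, (hP x).2 hx.2⟩
    · intro x hx
      rw [Finset.mem_filter] at hx ⊢
      exact ⟨hA x hx.1, fun h' => (hP x).1 h' hx.2⟩
  omega

/-- Two `A`-preserving involutions, one negating `P` and fixing `Q`, the other negating `Q`, quarter `A`. -/
theorem four_mul_card_filter {X : Type*} (A : Finset X) (f g : X → X) (P Q : X → Prop) [DecidablePred P]
    [DecidablePred Q] (hfA : ∀ x ∈ A, f x ∈ A) (hf : ∀ x, f (f x) = x) (hfP : ∀ x, P (f x) ↔ ¬ P x)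
    (hfQ : ∀ x, Q (f x) ↔ Q x) (hgA : ∀ x ∈ A, g x ∈ A) (hg : ∀ x, g (g x) = x) (hgQ : ∀ x, Q (g x) ↔ ¬ Q x) :
    4 * (A.filter fun x => P x ∧ Q x).card = A.card := by
  have h1 : 2 * (A.filter Q).card = A.card := two_mul_card_filter A g Q hgA hg hgQ
  have h2 : 2 * ((A.filter Q).filter P).card = (A.filter Q).card :=
    two_mul_card_filter (A.filter Q) f P (fun x hx => by
      rw [Finset.mem_filter] at hx ⊢
      exact ⟨hfA x hx.1, (hfQ x).2 hx.2⟩) hf hfP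
  have h3 : (A.filter Q).filter P = A.filter fun x => P x ∧ Q x := by
    rw [Finset.filter_filter]
    exact Finset.filter_congr fun x _ => and_comm
  rw [h3] at h2
  omega

/-! ## Apex parities, pattern sets, the section -/

variable {s : ℕ}

/-- The number of edges of `K_{s+1}`. -/
abbrev nE (s : ℕ) : ℕ := Fintype.card (Edge s)

/-- The apex-triangle parity `z_{0v⁺} ⊕ z_{0w⁺} ⊕ z_{v⁺w⁺}` of an edge labelling. -/
noncomputable def triXor (z : Fin (nE s) → Bool) (τ : Tri s) : Bool :=
  xor (xor (z (eEdge s (triEdge₁ τ))) (z (eEdge s (triEdge₂ τ)))) (z (eEdge s (triEdge₃ τ)))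

/-- The pattern set of prescribed apex parities `c` (a coset of `Cut(K_{s+1})`). -/
noncomputable def patSet (c : Tri s → Bool) : Finset (Fin (nE s) → Bool) := univ.filter fun z => ∀ τ, triXor z τ = c τ

/-- Membership in the pattern set. -/
theorem mem_patSet {c : Tri s → Bool} {z : Fin (nE s) → Bool} : z ∈ patSet c ↔ ∀ τ, triXor z τ = c τ := by
  simp [patSet]

/-- A section: `false` on the apex edges `{0, v⁺}`, the prescribed parity on the edges `{v⁺, w⁺}`. -/
noncomputable def zSec (c : Tri s → Bool) : Fin (nE s) → Bool := fun i =>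
  if h : ((eEdge s).symm i).1.1 = 0 then false else c (edgeTri ((eEdge s).symm i) h)

/-- The section lies in the pattern set. -/
theorem zSec_mem (c : Tri s → Bool) : zSec c ∈ patSet c := by
  rw [mem_patSet]
  intro τ
  have e1 : zSec c (eEdge s (triEdge₁ τ)) = false := by simp [zSec, triEdge₁]
  have e2 : zSec c (eEdge s (triEdge₂ τ)) = false := by simp [zSec, triEdge₂]
  have e3 : zSec c (eEdge s (triEdge₃ τ)) = c τ := by
    have hne : (triEdge₃ τ).1.1 ≠ 0 := Fin.succ_ne_zero _
    simp only [zSec, Equiv.symm_apply_apply, hne, dite_false, edgeTri_triEdge₃]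
  simp only [triXor, e1, e2, e3, Bool.false_xor]

/-- **Pattern sets are non-empty.** -/
theorem patSet_nonempty (c : Tri s → Bool) : (patSet c).Nonempty := ⟨zSec c, zSec_mem c⟩

/-! ## Single-vertex cut flips -/

/-- Incidence of the vertex `x` with the edge `e`. -/
def inc (x : Fin (s + 1)) (e : Edge s) : Bool := decide (x = e.1.1 ∨ x = e.1.2)

/-- Flip an edge labelling along the cut of the single vertex `x`. -/
noncomputable def cutFlip (x : Fin (s + 1)) (z : Fin (nE s) → Bool) : Fin (nE s) → Bool :=
  fun i => xor (z i) (inc x ((eEdge s).symm i))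

/-- Cut flips are involutions. -/
theorem cutFlip_cutFlip (x : Fin (s + 1)) (z : Fin (nE s) → Bool) : cutFlip x (cutFlip x z) = z := by
  funext i
  simp only [cutFlip, Bool.xor_assoc, Bool.xor_self, Bool.xor_false]

/-- The value of a cut flip on an edge. -/
theorem cutFlip_apply (x : Fin (s + 1)) (z : Fin (nE s) → Bool) (e : Edge s) :
    cutFlip x z (eEdge s e) = xor (z (eEdge s e)) (inc x e) := by
  simp only [cutFlip, Equiv.symm_apply_apply]

/-- A vertex lies on `0` or `2` edges of an apex triangle. -/
theorem inc_tri (x : Fin (s + 1)) (τ : Tri s) :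
    xor (xor (inc x (triEdge₁ τ)) (inc x (triEdge₂ τ))) (inc x (triEdge₃ τ)) = false := by
  have h1 : (0 : Fin (s + 1)) ≠ τ.1.1.succ := (Fin.succ_ne_zero _).symm
  have h2 : (0 : Fin (s + 1)) ≠ τ.1.2.succ := (Fin.succ_ne_zero _).symm
  have h3 : τ.1.1.succ ≠ τ.1.2.succ := succ_ne_succ_of_tri τ
  simp only [inc, triEdge₁, triEdge₂, triEdge₃]
  by_cases hx0 : x = 0
  · subst hx0
    simp [h1, h2]
  · by_cases hx1 : x = τ.1.1.succ
    · subst hx1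
      simp [hx0, h3]
    · by_cases hx2 : x = τ.1.2.succ
      · subst hx2
        simp [hx0, h3.symm]
      · simp [hx0, hx1, hx2]

/-- Cut flips preserve every apex parity. -/
theorem triXor_cutFlip (x : Fin (s + 1)) (z : Fin (nE s) → Bool) (τ : Tri s) :
    triXor (cutFlip x z) τ = triXor z τ := by
  simp only [triXor, cutFlip_apply]
  rw [xor3_xor3, inc_tri, Bool.xor_false]

/-- Cut flips preserve pattern sets. -/
theorem cutFlip_mem {c : Tri s → Bool} (x : Fin (s + 1)) {z : Fin (nE s) → Bool} (hz : z ∈ patSet c) :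
    cutFlip x z ∈ patSet c := by
  rw [mem_patSet] at hz ⊢
  intro τ
  rw [triXor_cutFlip]
  exact hz τ

/-- For two distinct edges some vertex lies on the first and off the second. -/
theorem exists_inc_ne {e e' : Edge s} (h : e ≠ e') : ∃ x : Fin (s + 1), inc x e = true ∧ inc x e' = false := by
  have lt := Fin.lt_def.1 e.2
  have lt' := Fin.lt_def.1 e'.2
  have hne : ¬ (e.1.1 = e'.1.1 ∧ e.1.2 = e'.1.2) := fun hh => h (Subtype.ext (Prod.ext hh.1 hh.2))
  simp only [Fin.ext_iff] at hne
  by_cases h1 : e.1.1 = e'.1.1 ∨ e.1.1 = e'.1.2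
  · refine ⟨e.1.2, by simp [inc], ?_⟩
    simp only [inc, decide_eq_false_iff_not, not_or, Fin.ext_iff] at h1 ⊢
    omega
  · exact ⟨e.1.1, by simp [inc], by simpa [inc] using h1⟩

/-! ## Uniformity -/

/-- **Pattern sets are 1-wise uniform.** -/
theorem unif1_patSet (c : Tri s → Bool) (i : Fin (nE s)) : Unif1 (patSet c) i := by
  intro τ
  refine two_mul_card_filter (patSet c) (cutFlip ((eEdge s).symm i).1.1) _ (fun z hz => cutFlip_mem _ hz)
    (cutFlip_cutFlip _) fun z => ?_
  have hinc : inc ((eEdge s).symm i).1.1 ((eEdge s).symm i) = true := by simp [inc]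
  simp only [cutFlip, hinc, Bool.xor_true]
  cases z i <;> cases τ <;> simp

/-- **Pattern sets are 2-wise uniform.** -/
theorem unif2_patSet (c : Tri s → Bool) {i i' : Fin (nE s)} (hii : i ≠ i') : Unif2 (patSet c) i i' := by
  intro τ τ'
  have hne : (eEdge s).symm i ≠ (eEdge s).symm i' := fun h => hii ((eEdge s).symm.injective h)
  obtain ⟨x, hx, hx'⟩ := exists_inc_ne hne
  obtain ⟨x', hx'', -⟩ := exists_inc_ne hne.symm
  refine four_mul_card_filter (patSet c) (cutFlip x) (cutFlip x') (fun z => z i = τ) (fun z => z i' = τ')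
    (fun z hz => cutFlip_mem _ hz) (cutFlip_cutFlip _) (fun z => ?_) (fun z => ?_) (fun z hz => cutFlip_mem _ hz)
    (cutFlip_cutFlip _) (fun z => ?_)
  · simp only [cutFlip, hx, Bool.xor_true]
    cases z i <;> cases τ <;> simp
  · simp only [cutFlip, hx', Bool.xor_false]
  · simp only [cutFlip, hx'', Bool.xor_true]
    cases z i' <;> cases τ' <;> simp

end Summit.PneNP.PneNP.Theorems.QuotientSACutCoset
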